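import Mathlib.Analysis.SpecialFunctions.Trigonometric.Inverse

/-!
# Three-term port sum: a strict violation of the adjacent-port inequality breaks antitonicity

For nonnegative masses `m₀, m₁, m₂` put
`Q(s) = m₀² + m₁² + m₂² + 2(m₀m₁ + m₁m₂)cos(2πs/3) + 2m₀m₂cos(4πs/3)`
(the squared modulus of the three-term port sum at a boundary-adjacent target).
With `c = cos(2πs/3)` one has `cos(4πs/3) = 2c² - 1`, `Q(3/2)` corresponds to `c = -1`, and
`Q(s) - Q(3/2) = 2(1 + c)·[m₁(m₀ + m₂) - 4m₀m₂ + 2m₀m₂(1 + c)]`.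
If `m₁(m₀ + m₂) < 4m₀m₂`, choosing `1 + c = η` with `0 < η ≤ min 1 (D/(4m₀m₂))`,
`D = 4m₀m₂ - m₁(m₀ + m₂)`, and `s = 3·arccos(η - 1)/(2π) ∈ [0, 3/2]` gives `Q(s) < Q(3/2)`,
so `Q` is not antitone on `[0, 3/2]`.
-/

noncomputable section

namespace Summit.CriticalPhenomena.SAWScalingLimit.Cruxes.SpinMonotone.AdjacentPort

/-- Double-angle rewrite `cos(4πs/3) = 2cos(2πs/3)² - 1`. -/
private theorem cos_four_pi_mul_div_three (s : ℝ) :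
    Real.cos (4 * Real.pi * s / 3) = 2 * Real.cos (2 * Real.pi * s / 3) ^ 2 - 1 := by
  rw [show 4 * Real.pi * s / 3 = 2 * (2 * Real.pi * s / 3) by ring, Real.cos_two_mul]

/-- For every `c ∈ [-1, 1]` there is `t ∈ [0, 3/2]` with `cos(2πt/3) = c`, namely `t = 3·arccos(c)/(2π)`. -/
private theorem exists_Icc_cos_eq (c : ℝ) (hc₁ : -1 ≤ c) (hc₂ : c ≤ 1) :
    ∃ t : ℝ, 0 ≤ t ∧ t ≤ 3 / 2 ∧ Real.cos (2 * Real.pi * t / 3) = c := by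
  have hπ : 0 < Real.pi := Real.pi_pos
  refine ⟨3 * Real.arccos c / (2 * Real.pi), ?_, ?_, ?_⟩
  · exact div_nonneg (mul_nonneg (by norm_num) (Real.arccos_nonneg c)) (by linarith)
  · rw [div_le_iff₀ (by linarith : (0 : ℝ) < 2 * Real.pi)]
    linarith [Real.arccos_le_pi c]
  · have h : 2 * Real.pi * (3 * Real.arccos c / (2 * Real.pi)) / 3 = Real.arccos c := by
      field_simp
    rw [h, Real.cos_arccos hc₁ hc₂]

/-- S2 (real analysis): a strict violation of `4m₀m₂ ≤ m₁(m₀+m₂)` makes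
`Q(s) = m₀² + m₁² + m₂² + 2(m₀m₁ + m₁m₂)cos(2πs/3) + 2m₀m₂cos(4πs/3)` increase just below `s = 3/2`,
so `Q` is not antitone on `[0, 3/2]`. -/
theorem stub_threeTermViolation : ∀ (m₀ m₁ m₂ : ℝ), 0 ≤ m₀ → 0 ≤ m₁ → 0 ≤ m₂ →
    m₁ * (m₀ + m₂) < 4 * m₀ * m₂ →
    ¬ AntitoneOn (fun s : ℝ => m₀ ^ 2 + m₁ ^ 2 + m₂ ^ 2 +
        2 * (m₀ * m₁ + m₁ * m₂) * Real.cos (2 * Real.pi * s / 3) +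
        2 * (m₀ * m₂) * Real.cos (4 * Real.pi * s / 3)) (Set.Icc (0 : ℝ) (3 / 2)) := by
  intro m₀ m₁ m₂ h₀ h₁ h₂ hlt hanti
  -- the defect `D = 4m₀m₂ - m₁(m₀ + m₂)` is positive, hence so is `m₀m₂`
  have hD : 0 < 4 * m₀ * m₂ - m₁ * (m₀ + m₂) := by linarith
  have hP : 0 < 4 * m₀ * m₂ := by nlinarith [mul_nonneg h₁ (add_nonneg h₀ h₂)]
  -- choose `η = 1 + c ∈ (0, 1]` with `4m₀m₂η ≤ D`
  obtain ⟨η, hη₀, hη₁, hηD⟩ : ∃ η : ℝ, 0 < η ∧ η ≤ 1 ∧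
      4 * m₀ * m₂ * η ≤ 4 * m₀ * m₂ - m₁ * (m₀ + m₂) := by
    refine ⟨min 1 ((4 * m₀ * m₂ - m₁ * (m₀ + m₂)) / (4 * m₀ * m₂)), lt_min one_pos (div_pos hD hP),
      min_le_left _ _, ?_⟩
    calc 4 * m₀ * m₂ * min 1 ((4 * m₀ * m₂ - m₁ * (m₀ + m₂)) / (4 * m₀ * m₂))
        ≤ 4 * m₀ * m₂ * ((4 * m₀ * m₂ - m₁ * (m₀ + m₂)) / (4 * m₀ * m₂)) :=
          mul_le_mul_of_nonneg_left (min_le_right _ _) hP.le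
      _ = 4 * m₀ * m₂ - m₁ * (m₀ + m₂) := mul_div_cancel₀ _ hP.ne'
  -- the point `t ∈ [0, 3/2]` with `cos(2πt/3) = η - 1`
  obtain ⟨t, ht₀, ht₁, hcos⟩ := exists_Icc_cos_eq (η - 1) (by linarith) (by linarith)
  have hmem_t : t ∈ Set.Icc (0 : ℝ) (3 / 2) := ⟨ht₀, ht₁⟩
  have hmem_b : (3 / 2 : ℝ) ∈ Set.Icc (0 : ℝ) (3 / 2) := ⟨by norm_num, le_rfl⟩
  -- the cosines at `t` and at `3/2`
  have hc2 : Real.cos (4 * Real.pi * t / 3) = 2 * (η - 1) ^ 2 - 1 := by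
    rw [cos_four_pi_mul_div_three, hcos]
  have hb1 : Real.cos (2 * Real.pi * (3 / 2 : ℝ) / 3) = -1 := by
    rw [show 2 * Real.pi * (3 / 2 : ℝ) / 3 = Real.pi by ring, Real.cos_pi]
  have hb2 : Real.cos (4 * Real.pi * (3 / 2 : ℝ) / 3) = 1 := by
    rw [show 4 * Real.pi * (3 / 2 : ℝ) / 3 = 2 * Real.pi by ring, Real.cos_two_pi]
  -- antitonicity would give `Q(3/2) ≤ Q(t)`, but `Q(t) - Q(3/2) = 2η(-D + 2m₀m₂η) < 0`
  have key := hanti hmem_t hmem_b ht₁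
  simp only [hcos, hc2, hb1, hb2] at key
  have hneg : 0 < η * ((4 * m₀ * m₂ - m₁ * (m₀ + m₂)) - 2 * m₀ * m₂ * η) :=
    mul_pos hη₀ (by linarith)
  nlinarith [hneg]

end Summit.CriticalPhenomena.SAWScalingLimit.Cruxes.SpinMonotone.AdjacentPort

end
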